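import Mathlib
import HarnessLib

/-!
# `CageBudgetFekete.UnboundedHeatVariance`, line `Sketch` — the flat-topped Fejér profile

Support file (`--supports stmt-AtomisticToContinuum-15771`) proving the registered stub
`stub_flatFejerProfile` (F) of line `Sketch`: the explicit witness family behind the line's
tightness theorem. With the Fejér weights `a n x = n⁻²·#{(i,j) ∈ [0,n)² : i − j = x}`, their
self-convolution `c n x = n⁻⁴·#{(i,j,i',j') : (i−j)+(i'−j') = x}` and the profile
`P n m x = 2·a n x − c n x − m·(a n x − (a n (x−1) + a n (x+1))/2)`, for `n ≥ 2` and
`0 ≤ m ≤ 1/2`: `P n m` vanishes off `|x| ≤ 2n`, is summable against `1 + x²`, has total mass `1`,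
second moment exactly `m` (flat top), sup norm `≤ 4/n`, cosine transform
`T(k) = Σ_x cos(kx)·P n m x = u(2 − u − m(1 − cos k)) ∈ [0,1]` with
`u(k) = n⁻²[(Σ_{i<n} cos ki)² + (Σ_{i<n} sin ki)²] ∈ [0,1]`, and `T(2π/n) = 0` (roots of unity).

Pure finite trigonometric algebra. Every series `Σ'_x F(x)·(weights)` is pushed through the finite
index sums and collapsed on the one-point support of each Kronecker delta (`hasSum_single`), so no
closed form `(n − |x|)⁺` and no convolution reindexing is needed; the rest is `Finset` algebra,
the addition formulas, and `IsPrimitiveRoot.geom_sum_eq_zero` for `Σ_{i<n} exp(2πi·i/n) = 0`.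
-/

open Finset

namespace Summit.AtomisticToContinuum.FouriersLaw.Theorems.UnboundedHeatVariance.Sketch

/-! ## Series against Kronecker deltas -/

/-- Pushing a series through a finite sum of Kronecker deltas: `Σ'_x F(x)·w·Σ_{p∈s}[d p = x] =
w·Σ_{p∈s} F(d p)`, as a `HasSum` statement (each delta is supported at one point). [folklore] -/
private theorem hasSum_mul_sum_ite {σ : Type*} (s : Finset σ) (d : σ → ℤ) (F : ℤ → ℝ) (w : ℝ) :
    HasSum (fun x : ℤ => F x * (w * ∑ p ∈ s, if d p = x then (1 : ℝ) else 0))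
      (w * ∑ p ∈ s, F (d p)) := by
  have h : ∀ p ∈ s, HasSum (fun x : ℤ => F x * (w * if d p = x then (1 : ℝ) else 0))
      (w * F (d p)) := by
    intro p _
    have := hasSum_single (f := fun x : ℤ => F x * (w * if d p = x then (1 : ℝ) else 0)) (d p)
      (fun x hx => by simp [Ne.symm hx])
    simpa [mul_comm] using this
  simp_rw [Finset.mul_sum]
  exact hasSum_sum h

/-- Two-index version of `hasSum_mul_sum_ite`. [folklore] -/
private theorem hasSum_mul_sum₂_ite {σ τ : Type*} (s : Finset σ) (t : Finset τ) (d : σ → τ → ℤ)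
    (F : ℤ → ℝ) (w : ℝ) :
    HasSum (fun x : ℤ => F x * (w * ∑ i ∈ s, ∑ j ∈ t, if d i j = x then (1 : ℝ) else 0))
      (w * ∑ i ∈ s, ∑ j ∈ t, F (d i j)) := by
  have h := hasSum_mul_sum_ite (s ×ˢ t) (fun p => d p.1 p.2) F w
  simp only [Finset.sum_product] at h
  exact h

/-- Four-index version of `hasSum_mul_sum_ite`. [folklore] -/
private theorem hasSum_mul_sum₄_ite {σ : Type*} (s : Finset σ) (d : σ → σ → σ → σ → ℤ)
    (F : ℤ → ℝ) (w : ℝ) :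
    HasSum (fun x : ℤ => F x *
        (w * ∑ i ∈ s, ∑ j ∈ s, ∑ i' ∈ s, ∑ j' ∈ s, if d i j i' j' = x then (1 : ℝ) else 0))
      (w * ∑ i ∈ s, ∑ j ∈ s, ∑ i' ∈ s, ∑ j' ∈ s, F (d i j i' j')) := by
  have h := hasSum_mul_sum_ite ((s ×ˢ s) ×ˢ (s ×ˢ s)) (fun q => d q.1.1 q.1.2 q.2.1 q.2.2) F w
  simp only [Finset.sum_product] at h
  exact h

/-- The transform of the flat Fejér profile against an arbitrary test function `F : ℤ → ℝ`, as
finite sums over the index box: `Σ'_x F(x)·P n m x = 2n⁻²A − n⁻⁴C − m·(n⁻²A − (n⁻²A₊ + n⁻²A₋)/2)`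
with `A = Σ_{i,j} F(i−j)`, `A₊ = Σ F(i−j+1)`, `A₋ = Σ F(i−j−1)`, `C = Σ_{i,j,i',j'} F((i−j)+(i'−j'))`.
[folklore] -/
private theorem hasSum_mul_profile (a : ℕ → ℤ → ℝ)
    (ha : a = fun (n : ℕ) (x : ℤ) => ((n : ℝ) ^ 2)⁻¹ * ∑ i ∈ Finset.range n, ∑ j ∈ Finset.range n,
      if (i : ℤ) - (j : ℤ) = x then (1 : ℝ) else 0)
    (c : ℕ → ℤ → ℝ)
    (hc : c = fun (n : ℕ) (x : ℤ) => ((n : ℝ) ^ 4)⁻¹ * ∑ i ∈ Finset.range n, ∑ j ∈ Finset.range n,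
      ∑ i' ∈ Finset.range n, ∑ j' ∈ Finset.range n,
        if (i : ℤ) - (j : ℤ) + ((i' : ℤ) - (j' : ℤ)) = x then (1 : ℝ) else 0)
    (P : ℕ → ℝ → ℤ → ℝ)
    (hP : P = fun (n : ℕ) (m : ℝ) (x : ℤ) =>
      2 * a n x - c n x - m * (a n x - (a n (x - 1) + a n (x + 1)) / 2))
    (n : ℕ) (m : ℝ) (F : ℤ → ℝ) :
    HasSum (fun x : ℤ => F x * P n m x)
      (2 * (((n : ℝ) ^ 2)⁻¹ * ∑ i ∈ range n, ∑ j ∈ range n, F ((i : ℤ) - j))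
        - ((n : ℝ) ^ 4)⁻¹ * ∑ i ∈ range n, ∑ j ∈ range n, ∑ i' ∈ range n, ∑ j' ∈ range n,
            F ((i : ℤ) - j + ((i' : ℤ) - j'))
        - m * (((n : ℝ) ^ 2)⁻¹ * ∑ i ∈ range n, ∑ j ∈ range n, F ((i : ℤ) - j)
          - (((n : ℝ) ^ 2)⁻¹ * ∑ i ∈ range n, ∑ j ∈ range n, F ((i : ℤ) - j + 1)
            + ((n : ℝ) ^ 2)⁻¹ * ∑ i ∈ range n, ∑ j ∈ range n, F ((i : ℤ) - j - 1)) / 2)) := by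
  have hA : HasSum (fun x : ℤ => F x * a n x)
      (((n : ℝ) ^ 2)⁻¹ * ∑ i ∈ range n, ∑ j ∈ range n, F ((i : ℤ) - j)) := by
    rw [ha]
    exact hasSum_mul_sum₂_ite (range n) (range n) (fun i j => (i : ℤ) - j) F _
  have hAp : HasSum (fun x : ℤ => F x * a n (x - 1))
      (((n : ℝ) ^ 2)⁻¹ * ∑ i ∈ range n, ∑ j ∈ range n, F ((i : ℤ) - j + 1)) := by
    rw [← (Equiv.addRight (1 : ℤ)).hasSum_iff]
    simp only [Function.comp_def, Equiv.coe_addRight, add_sub_cancel_right, ha]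
    exact hasSum_mul_sum₂_ite (range n) (range n) (fun i j => (i : ℤ) - j) (fun y => F (y + 1)) _
  have hAm : HasSum (fun x : ℤ => F x * a n (x + 1))
      (((n : ℝ) ^ 2)⁻¹ * ∑ i ∈ range n, ∑ j ∈ range n, F ((i : ℤ) - j - 1)) := by
    rw [← (Equiv.subRight (1 : ℤ)).hasSum_iff]
    simp only [Function.comp_def, Equiv.subRight_apply, sub_add_cancel, ha]
    exact hasSum_mul_sum₂_ite (range n) (range n) (fun i j => (i : ℤ) - j) (fun y => F (y - 1)) _
  have hC : HasSum (fun x : ℤ => F x * c n x)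
      (((n : ℝ) ^ 4)⁻¹ * ∑ i ∈ range n, ∑ j ∈ range n, ∑ i' ∈ range n, ∑ j' ∈ range n,
            F ((i : ℤ) - j + ((i' : ℤ) - j'))) := by
    rw [hc]
    exact hasSum_mul_sum₄_ite (range n) (fun i j i' j' => (i : ℤ) - j + ((i' : ℤ) - j')) F _
  have h := ((hA.mul_left 2).sub hC).sub ((hA.sub ((hAp.add hAm).div_const 2)).mul_left m)
  have e : (fun x : ℤ => F x * P n m x) = fun x : ℤ => 2 * (F x * a n x) - F x * c n x
      - m * (F x * a n x - (F x * a n (x - 1) + F x * a n (x + 1)) / 2) := by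
    funext x
    simp only [hP]
    ring
  rw [e]
  exact h

/-! ## Finite-sum identities over the index box -/

/-- `Σ_{i,j∈S} (i − j) = 0`. [folklore] -/
private theorem sum_sum_sub (S : Finset ℕ) : ∑ i ∈ S, ∑ j ∈ S, ((i : ℝ) - j) = 0 := by
  simp only [Finset.sum_sub_distrib, Finset.sum_const, nsmul_eq_mul, ← Finset.mul_sum]
  ring

/-- `Σ_{i,j,i',j'∈S} ((i − j) + (i' − j'))² = 2·#S²·Σ_{i,j∈S} (i − j)²` (the odd cross term
vanishes). [folklore] -/
private theorem sum₄_add_sq (S : Finset ℕ) :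
    ∑ i ∈ S, ∑ j ∈ S, ∑ i' ∈ S, ∑ j' ∈ S, ((i : ℝ) - j + ((i' : ℝ) - j')) ^ 2 =
      2 * (#S : ℝ) ^ 2 * ∑ i ∈ S, ∑ j ∈ S, ((i : ℝ) - j) ^ 2 := by
  have e : ∀ i j i' j' : ℕ, ((i : ℝ) - j + ((i' : ℝ) - j')) ^ 2 =
      ((i : ℝ) - j) ^ 2 * 1 + 1 * ((i' : ℝ) - j') ^ 2 + 2 * ((i : ℝ) - j) * ((i' : ℝ) - j') := by
    intro i j i' j'; ring
  simp_rw [e, Finset.sum_add_distrib, ← Finset.mul_sum, ← Finset.sum_mul, sum_sum_sub,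
    Finset.sum_const, nsmul_eq_mul]
  ring

/-- `w·Σ (i−j+1)² + w·Σ (i−j−1)² = w·(2·Σ (i−j)² + 2·#S²)`. [folklore] -/
private theorem sum_sum_shift_sq (S : Finset ℕ) (w : ℝ) :
    w * ∑ i ∈ S, ∑ j ∈ S, ((i : ℝ) - j + 1) ^ 2 + w * ∑ i ∈ S, ∑ j ∈ S, ((i : ℝ) - j - 1) ^ 2 =
      w * (2 * ∑ i ∈ S, ∑ j ∈ S, ((i : ℝ) - j) ^ 2 + 2 * (#S : ℝ) ^ 2) := by
  rw [← mul_add, ← Finset.sum_add_distrib]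
  simp_rw [← Finset.sum_add_distrib]
  have e : ∀ i j : ℕ, ((i : ℝ) - j + 1) ^ 2 + ((i : ℝ) - j - 1) ^ 2 =
      2 * ((i : ℝ) - j) ^ 2 + 2 := by
    intro i j; ring
  simp_rw [e, Finset.sum_add_distrib, Finset.sum_const, nsmul_eq_mul, ← Finset.mul_sum]
  ring

/-- `Σ_{i,j∈S} cos(k(i−j)) = (Σ cos ki)² + (Σ sin ki)²`. [folklore] -/
private theorem sum_sum_cos_sub (S : Finset ℕ) (k : ℝ) :
    ∑ i ∈ S, ∑ j ∈ S, Real.cos (k * ((i : ℝ) - j)) =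
      (∑ i ∈ S, Real.cos (k * i)) ^ 2 + (∑ i ∈ S, Real.sin (k * i)) ^ 2 := by
  have e : ∀ i j : ℕ, Real.cos (k * ((i : ℝ) - j)) =
      Real.cos (k * i) * Real.cos (k * j) + Real.sin (k * i) * Real.sin (k * j) := by
    intro i j; rw [mul_sub, Real.cos_sub]
  simp_rw [e, Finset.sum_add_distrib, ← Finset.mul_sum, ← Finset.sum_mul, sq]

/-- `Σ_{i,j∈S} sin(k(i−j)) = 0` (antisymmetry). [folklore] -/
private theorem sum_sum_sin_sub (S : Finset ℕ) (k : ℝ) :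
    ∑ i ∈ S, ∑ j ∈ S, Real.sin (k * ((i : ℝ) - j)) = 0 := by
  have e : ∀ i j : ℕ, Real.sin (k * ((i : ℝ) - j)) =
      Real.sin (k * i) * Real.cos (k * j) - Real.cos (k * i) * Real.sin (k * j) := by
    intro i j; rw [mul_sub, Real.sin_sub]
  simp_rw [e, Finset.sum_sub_distrib, ← Finset.mul_sum, ← Finset.sum_mul]
  ring

/-- `Σ_{i,j,i',j'} cos(k((i−j)+(i'−j'))) = (Σ_{i,j} cos(k(i−j)))²`. [folklore] -/
private theorem sum₄_cos_add (S : Finset ℕ) (k : ℝ) :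
    ∑ i ∈ S, ∑ j ∈ S, ∑ i' ∈ S, ∑ j' ∈ S, Real.cos (k * ((i : ℝ) - j + ((i' : ℝ) - j'))) =
      (∑ i ∈ S, ∑ j ∈ S, Real.cos (k * ((i : ℝ) - j))) ^ 2 := by
  have e : ∀ i j i' j' : ℕ, Real.cos (k * ((i : ℝ) - j + ((i' : ℝ) - j'))) =
      Real.cos (k * ((i : ℝ) - j)) * Real.cos (k * ((i' : ℝ) - j'))
        - Real.sin (k * ((i : ℝ) - j)) * Real.sin (k * ((i' : ℝ) - j')) := by
    intro i j i' j'; rw [mul_add, Real.cos_add]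
  simp_rw [e, Finset.sum_sub_distrib, ← Finset.mul_sum, ← Finset.sum_mul, sum_sum_sin_sub]
  ring

/-- `w·Σ cos(k(i−j+1)) + w·Σ cos(k(i−j−1)) = w·(2 cos k · Σ cos(k(i−j)))`. [folklore] -/
private theorem sum_sum_cos_shift (S : Finset ℕ) (k w : ℝ) :
    w * ∑ i ∈ S, ∑ j ∈ S, Real.cos (k * ((i : ℝ) - j + 1)) +
        w * ∑ i ∈ S, ∑ j ∈ S, Real.cos (k * ((i : ℝ) - j - 1)) =
      w * (2 * Real.cos k * ∑ i ∈ S, ∑ j ∈ S, Real.cos (k * ((i : ℝ) - j))) := by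
  rw [← mul_add, ← Finset.sum_add_distrib]
  simp_rw [← Finset.sum_add_distrib]
  have e : ∀ i j : ℕ, Real.cos (k * ((i : ℝ) - j + 1)) + Real.cos (k * ((i : ℝ) - j - 1)) =
      2 * Real.cos k * Real.cos (k * ((i : ℝ) - j)) := by
    intro i j
    have h1 : k * ((i : ℝ) - j + 1) = k * ((i : ℝ) - j) + k := by ring
    have h2 : k * ((i : ℝ) - j - 1) = k * ((i : ℝ) - j) - k := by ring
    rw [h1, h2, Real.cos_add, Real.cos_sub]
    ring
  simp_rw [e, ← Finset.mul_sum]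

/-- `Σ_{i<n} cos(2πi/n) = 0` and `Σ_{i<n} sin(2πi/n) = 0` for `n ≥ 2` (sum of the `n`-th roots of
unity, `IsPrimitiveRoot.geom_sum_eq_zero`). [folklore] -/
private theorem sum_cos_sin_root (n : ℕ) (hn : 2 ≤ n) :
    ∑ i ∈ range n, Real.cos (2 * Real.pi / n * i) = 0 ∧
      ∑ i ∈ range n, Real.sin (2 * Real.pi / n * i) = 0 := by
  have hprim := Complex.isPrimitiveRoot_exp n (by omega)
  have hsum := hprim.geom_sum_eq_zero (by omega : 1 < n)
  have key : ∀ i : ℕ, Complex.exp (2 * Real.pi * Complex.I / n) ^ i =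
      (Real.cos (2 * Real.pi / n * i) : ℂ) + (Real.sin (2 * Real.pi / n * i) : ℂ) * Complex.I := by
    intro i
    rw [← Complex.exp_nat_mul, Complex.ofReal_cos, Complex.ofReal_sin, ← Complex.exp_mul_I]
    congr 1
    push_cast
    ring
  simp_rw [key, Finset.sum_add_distrib, ← Finset.sum_mul] at hsum
  have hre := congrArg Complex.re hsum
  have him := congrArg Complex.im hsum
  simp only [Complex.add_re, Complex.re_sum, Complex.ofReal_re, Complex.mul_I_re, Complex.im_sum,
    Complex.ofReal_im, Finset.sum_const_zero, neg_zero, add_zero, Complex.zero_re] at hre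
  simp only [Complex.add_im, Complex.im_sum, Complex.ofReal_im, Complex.mul_I_im, Complex.re_sum,
    Complex.ofReal_re, Finset.sum_const_zero, zero_add, Complex.zero_im] at him
  exact ⟨hre, him⟩

/-! ## Support and size of the weights -/

/-- A sum of indicators of pairwise incompatible conditions is at most one. [folklore] -/
private theorem sum_ite_le_one (s : Finset ℕ) (p : ℕ → Prop) [DecidablePred p]
    (h : ∀ a b, p a → p b → a = b) : ∑ j ∈ s, (if p j then (1 : ℝ) else 0) ≤ 1 := by
  rw [Finset.sum_boole]
  exact_mod_cast Finset.card_le_one.mpr fun a ha b hb =>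
    h a b (Finset.mem_filter.mp ha).2 (Finset.mem_filter.mp hb).2

/-- Support, sign and size of the Fejér weights `a n y = n⁻²·#{(i,j) : i − j = y}`:
`a n y = 0` for `n ≤ |y|`, and `0 ≤ a n y ≤ 1/n`. [folklore] -/
private theorem fejer_weight_facts (a : ℕ → ℤ → ℝ)
    (ha : a = fun (n : ℕ) (x : ℤ) => ((n : ℝ) ^ 2)⁻¹ * ∑ i ∈ Finset.range n, ∑ j ∈ Finset.range n,
      if (i : ℤ) - (j : ℤ) = x then (1 : ℝ) else 0)
    (n : ℕ) (hn : 0 < n) (y : ℤ) :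
    ((n : ℤ) ≤ |y| → a n y = 0) ∧ 0 ≤ a n y ∧ a n y ≤ 1 / n := by
  subst ha
  refine ⟨fun hy => ?_, ?_, ?_⟩
  · refine mul_eq_zero_of_right _ (Finset.sum_eq_zero fun i hi => Finset.sum_eq_zero fun j hj => ?_)
    rw [Finset.mem_range] at hi hj
    rw [if_neg]
    rcases le_abs.mp hy with h | h <;> omega
  · exact mul_nonneg (inv_nonneg.mpr (pow_nonneg (Nat.cast_nonneg n) 2))
      (Finset.sum_nonneg fun i _ => Finset.sum_nonneg fun j _ => by split_ifs <;> norm_num)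
  · have h2 : ∑ i ∈ range n, ∑ j ∈ range n, (if (i : ℤ) - j = y then (1 : ℝ) else 0) ≤ n := by
      calc _ ≤ ∑ i ∈ range n, (1 : ℝ) :=
            Finset.sum_le_sum fun i _ => sum_ite_le_one _ _ fun a b ha hb => by omega
        _ = n := by simp
    have hn' : (0 : ℝ) < n := by exact_mod_cast hn
    calc ((n : ℝ) ^ 2)⁻¹ * ∑ i ∈ range n, ∑ j ∈ range n, (if (i : ℤ) - j = y then (1 : ℝ) else 0)
        ≤ ((n : ℝ) ^ 2)⁻¹ * n := mul_le_mul_of_nonneg_left h2 (by positivity)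
      _ = 1 / n := by field_simp

/-- Support, sign and size of the self-convolution `c n y = n⁻⁴·#{(i,j,i',j') : (i−j)+(i'−j') = y}`:
`c n y = 0` for `2n − 1 ≤ |y|`, and `0 ≤ c n y ≤ 1/n`. [folklore] -/
private theorem fejer_conv_facts (c : ℕ → ℤ → ℝ)
    (hc : c = fun (n : ℕ) (x : ℤ) => ((n : ℝ) ^ 4)⁻¹ * ∑ i ∈ Finset.range n, ∑ j ∈ Finset.range n,
      ∑ i' ∈ Finset.range n, ∑ j' ∈ Finset.range n,
        if (i : ℤ) - (j : ℤ) + ((i' : ℤ) - (j' : ℤ)) = x then (1 : ℝ) else 0)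
    (n : ℕ) (hn : 0 < n) (y : ℤ) :
    (2 * (n : ℤ) - 1 ≤ |y| → c n y = 0) ∧ 0 ≤ c n y ∧ c n y ≤ 1 / n := by
  subst hc
  refine ⟨fun hy => ?_, ?_, ?_⟩
  · refine mul_eq_zero_of_right _ (Finset.sum_eq_zero fun i hi => Finset.sum_eq_zero fun j hj =>
      Finset.sum_eq_zero fun i' hi' => Finset.sum_eq_zero fun j' hj' => ?_)
    rw [Finset.mem_range] at hi hj hi' hj'
    rw [if_neg]
    rcases le_abs.mp hy with h | h <;> omega
  · exact mul_nonneg (inv_nonneg.mpr (pow_nonneg (Nat.cast_nonneg n) 4))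
      (Finset.sum_nonneg fun i _ => Finset.sum_nonneg fun j _ => Finset.sum_nonneg fun i' _ =>
        Finset.sum_nonneg fun j' _ => by split_ifs <;> norm_num)
  · have h2 : ∑ i ∈ range n, ∑ j ∈ range n, ∑ i' ∈ range n, ∑ j' ∈ range n,
        (if (i : ℤ) - j + ((i' : ℤ) - j') = y then (1 : ℝ) else 0) ≤ n ^ 3 := by
      calc _ ≤ ∑ i ∈ range n, ∑ j ∈ range n, ∑ i' ∈ range n, (1 : ℝ) :=
            Finset.sum_le_sum fun i _ => Finset.sum_le_sum fun j _ => Finset.sum_le_sum fun i' _ =>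
              sum_ite_le_one _ _ fun a b ha hb => by omega
        _ = n ^ 3 := by simp; ring
    have hn' : (0 : ℝ) < n := by exact_mod_cast hn
    calc ((n : ℝ) ^ 4)⁻¹ * ∑ i ∈ range n, ∑ j ∈ range n, ∑ i' ∈ range n, ∑ j' ∈ range n,
          (if (i : ℤ) - j + ((i' : ℤ) - j') = y then (1 : ℝ) else 0)
        ≤ ((n : ℝ) ^ 4)⁻¹ * n ^ 3 := mul_le_mul_of_nonneg_left h2 (by positivity)
      _ = 1 / n := by field_simp

/-! ## The registered stub -/

/-- **F — `stub_flatFejerProfile` (the flat-topped Fejér profile on `ℤ`).** For `n ≥ 2` and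
`0 ≤ m ≤ 1/2`, the profile `P n m = 2a − a⋆a − m·(a − ½(a(·−1) + a(·+1)))` built from the Fejér
weights `a n x = n⁻²#{(i,j) ∈ [0,n)² : i − j = x}` is supported in `|x| ≤ 2n`, summable against
`1 + x²`, has mass `1`, second moment exactly `m`, sup norm `≤ 4/n`, cosine transform in `[0, 1]`
(it equals `u(2 − u − m(1 − cos k))` with `u = n⁻²|Σ_{i<n} e^{iki}|² ∈ [0,1]`), vanishing at
`k = 2π/n`. [folklore] -/
theorem stub_flatFejerProfile :
    ∀ a : ℕ → ℤ → ℝ, a = (fun (n : ℕ) (x : ℤ) => ((n : ℝ) ^ 2)⁻¹ * ∑ i ∈ Finset.range n, ∑ j ∈ Finset.range n, if (i : ℤ) - (j : ℤ) = x then (1 : ℝ) else 0) → ∀ c : ℕ → ℤ → ℝ, c = (fun (n : ℕ) (x : ℤ) => ((n : ℝ) ^ 4)⁻¹ * ∑ i ∈ Finset.range n, ∑ j ∈ Finset.range n, ∑ i' ∈ Finset.range n, ∑ j' ∈ Finset.range n, if (i : ℤ) - (j : ℤ) + ((i' : ℤ) - (j' : ℤ)) = x then (1 : ℝ) else 0)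 → ∀ P : ℕ → ℝ → ℤ → ℝ, P = (fun (n : ℕ) (m : ℝ) (x : ℤ) => 2 * a n x - c n x - m * (a n x - (a n (x - 1) + a n (x + 1)) / 2)) → ∀ n : ℕ, 2 ≤ n → ∀ m : ℝ, 0 ≤ m → m ≤ 1 / 2 → (∀ x : ℤ, 2 * (n : ℤ) < |x| → P n m x = 0) ∧ Summable (fun x : ℤ => (1 + (x : ℝ) ^ 2) * |P n m x|) ∧ ∑' x : ℤ, P n m x = 1 ∧ ∑' x : ℤ, (x : ℝ) ^ 2 * P n m x = m ∧ (∀ x : ℤ, |P n m x| ≤ 4 / (n : ℝ)) ∧ (∀ k : ℝ, 0 ≤ ∑' x : ℤ, Real.cos (k * (x : ℝ)) * P n m x ∧ ∑' x : ℤ, Real.cos (k * (x : ℝ)) * P n m x ≤ 1) ∧ ∑' x : ℤ, Real.cos (2 * Real.pi / (n : ℝ) * (x : ℝ)) * P n m x = 0 := by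
  intro a ha c hc P hP n hn m hm0 hm1
  have hn0 : 0 < n := by omega
  have hnR : (0 : ℝ) < n := by exact_mod_cast hn0
  have hA := fejer_weight_facts a ha n hn0
  have hCf := fejer_conv_facts c hc n hn0
  have hPx : ∀ x : ℤ, P n m x = 2 * a n x - c n x - m * (a n x - (a n (x - 1) + a n (x + 1)) / 2) :=
    fun x => by rw [hP]
  -- support
  have hsupp : ∀ x : ℤ, 2 * (n : ℤ) < |x| → P n m x = 0 := by
    intro x hx
    have hx' := lt_abs.mp hx
    rw [hPx, (hA x).1 (le_abs.mpr (by omega)), (hA (x - 1)).1 (le_abs.mpr (by omega)),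
      (hA (x + 1)).1 (le_abs.mpr (by omega)), (hCf x).1 (le_abs.mpr (by omega))]
    ring
  -- the transform against a test function
  have hT := hasSum_mul_profile a ha c hc P hP n m
  -- the cosine transform in closed form
  have hcos : ∀ k : ℝ, ∑' x : ℤ, Real.cos (k * (x : ℝ)) * P n m x =
      ((n : ℝ) ^ 2)⁻¹ * ((∑ i ∈ range n, Real.cos (k * i)) ^ 2 + (∑ i ∈ range n, Real.sin (k * i)) ^ 2)
        * (2 - ((n : ℝ) ^ 2)⁻¹ * ((∑ i ∈ range n, Real.cos (k * i)) ^ 2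
            + (∑ i ∈ range n, Real.sin (k * i)) ^ 2) - m * (1 - Real.cos k)) := by
    intro k
    rw [(hT (fun x : ℤ => Real.cos (k * (x : ℝ)))).tsum_eq]
    push_cast
    rw [sum₄_cos_add, sum_sum_cos_shift, sum_sum_cos_sub]
    ring
  have hu : ∀ k : ℝ, 0 ≤ ((n : ℝ) ^ 2)⁻¹ * ((∑ i ∈ range n, Real.cos (k * i)) ^ 2
      + (∑ i ∈ range n, Real.sin (k * i)) ^ 2) ∧
      ((n : ℝ) ^ 2)⁻¹ * ((∑ i ∈ range n, Real.cos (k * i)) ^ 2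
        + (∑ i ∈ range n, Real.sin (k * i)) ^ 2) ≤ 1 := by
    intro k
    refine ⟨by positivity, ?_⟩
    rw [← sum_sum_cos_sub]
    have h1 : ∑ i ∈ range n, ∑ j ∈ range n, Real.cos (k * ((i : ℝ) - j)) ≤ (n : ℝ) ^ 2 := by
      calc _ ≤ ∑ i ∈ range n, ∑ j ∈ range n, (1 : ℝ) :=
            Finset.sum_le_sum fun i _ => Finset.sum_le_sum fun j _ => Real.cos_le_one _
        _ = (n : ℝ) ^ 2 := by simp; ring
    calc ((n : ℝ) ^ 2)⁻¹ * ∑ i ∈ range n, ∑ j ∈ range n, Real.cos (k * ((i : ℝ) - j))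
        ≤ ((n : ℝ) ^ 2)⁻¹ * (n : ℝ) ^ 2 := mul_le_mul_of_nonneg_left h1 (by positivity)
      _ = 1 := by field_simp
  refine ⟨hsupp, ?_, ?_, ?_, ?_, ?_, ?_⟩
  · -- weighted summability: finite support
    refine summable_of_ne_finset_zero (s := Finset.Icc (-(2 * (n : ℤ))) (2 * n)) fun x hx => ?_
    rw [Finset.mem_Icc, not_and_or, not_le, not_le] at hx
    rw [hsupp x (lt_abs.mpr (by omega))]
    simp
  · -- total mass
    have h := (hT (fun _ : ℤ => (1 : ℝ))).tsum_eq
    simp only [one_mul] at h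
    rw [h]
    simp only [Finset.sum_const, Finset.card_range, nsmul_eq_mul, mul_one]
    field_simp
    ring
  · -- second moment (flat top)
    rw [(hT (fun x : ℤ => (x : ℝ) ^ 2)).tsum_eq]
    push_cast
    rw [sum₄_add_sq, sum_sum_shift_sq, Finset.card_range]
    field_simp
    ring
  · -- sup bound
    intro x
    have h0 := hA x; have h1 := hA (x - 1); have h2 := hA (x + 1); have h3 := hCf x
    have hma : m * a n x ≤ 1 / 2 * (1 / n) := mul_le_mul hm1 h0.2.2 h0.2.1 (by norm_num)
    have hma0 : 0 ≤ m * a n x := mul_nonneg hm0 h0.2.1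
    have hms : m * (a n (x - 1) + a n (x + 1)) ≤ 1 / 2 * (1 / n + 1 / n) :=
      mul_le_mul hm1 (add_le_add h1.2.2 h2.2.2) (add_nonneg h1.2.1 h2.2.1) (by norm_num)
    have hms0 : 0 ≤ m * (a n (x - 1) + a n (x + 1)) := mul_nonneg hm0 (add_nonneg h1.2.1 h2.2.1)
    have hinv : 0 ≤ 1 / (n : ℝ) := by positivity
    have h4n : 4 / (n : ℝ) = 4 * (1 / n) := by ring
    rw [hPx, abs_le]
    constructor
    · linarith [h0.2.1, h3.2.2]
    · linarith [h0.2.2, h3.2.1]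
  · -- the cosine transform lies in [0, 1]
    intro k
    rw [hcos k]
    obtain ⟨hu0, hu1⟩ := hu k
    set u := ((n : ℝ) ^ 2)⁻¹ * ((∑ i ∈ range n, Real.cos (k * i)) ^ 2
      + (∑ i ∈ range n, Real.sin (k * i)) ^ 2) with hu_def
    have hck := Real.cos_le_one k
    have hck' := Real.neg_one_le_cos k
    have h5 : m * (1 - Real.cos k) ≤ 1 := by nlinarith
    have h6 : 0 ≤ u * (m * (1 - Real.cos k)) := mul_nonneg hu0 (mul_nonneg hm0 (by linarith))
    constructor
    · exact mul_nonneg hu0 (by linarith)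
    · nlinarith [sq_nonneg (1 - u)]
  · -- the transform vanishes at k = 2π/n
    rw [hcos (2 * Real.pi / n)]
    obtain ⟨hc0, hs0⟩ := sum_cos_sin_root n hn
    rw [hc0, hs0]
    ring

end Summit.AtomisticToContinuum.FouriersLaw.Theorems.UnboundedHeatVariance.Sketch
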